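import Summits.CriticalPhenomena.SAWScalingLimit.Theorems.SAWDefectDecoherencePolygonParitySqueezeDefs
import Summits.CriticalPhenomena.SAWScalingLimit.Theorems.SAWDevelopingMapObservableToSLERestrictionCocycleHelpersFloor
import Literature.Probability.Percolation.TriLoopWinding
import HarnessLib

/-!
# Gate `∂̄`-limit, I: layers of the exact half-lattice above the gate
(crux `BoundaryClosureR`, stmt-CriticalPhenomena-14004, line `polygon-parity-squeeze`, registered
stub `stub_gateDbarLimit`, mechanism (C))

Lattice bookkeeping for the lattice → continuum limit `GateDbarLimit` (`N_δ(∂̄φ) → −i√3 ∫ φ e^{…}`,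
file `…GateDbarLimit.lean`).  Inside the pinned ball `B(c, ρ)` the family is the exact half-lattice
`{v | m ≤ v.1 1}`; its vertices with scaled centre in the quarter ball `B(c, ρ/4)` are organised in
ROWS `v.1 1 = m + k`, `k : ℕ`, and this file provides:

* `im_hexCenter_bounds` — heights of face centres in terms of the row;
* `deep_of_row` — a vertex of row `m + k` with scaled centre in `B(c, ρ/4)` is `(k+1)/2`-DEEP
  (every face within lattice distance `(k+1)/2` of it lies in `Λ`): the radius at which
  `DefectDecoherence` is applied in the twisted term;
* `exists_row_lt` — only the rows `k < ρ/δ` meet `B(c, ρ/4)` once the floor line is within `ρ/4`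
  of `im c`;
* `layerCake_le` — a weighted sum of star masses over the vertices of `Λ` with scaled centre in
  `B(c, ρ/4)` is bounded, row by row, by the gate layer budget
  (`δ Σ_{row k} starMass ≤ C_B (k+1)^{3/4} Z_b`);
* `sum_range_rpow_neg_le`, `sum_range_rpow_le`, `delta_mul_sum_decay_le`,
  `delta_sq_mul_sum_growth_le` — the two power sums this produces
  (`δ Σ_{k ≤ ρ/δ} (k+1)^{-s} = O(δ^s)`, `δ² Σ_{k ≤ ρ/δ} (k+1)^{3/4} = O(δ^{1/4})`).

References: H. Duminil-Copin, S. Smirnov, Ann. of Math. 175 (2012), §3; G. Lawler, O. Schramm,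
W. Werner (2004), §3.4 (the layer budget heuristics).  Everything here is proved.
-/

noncomputable section

open scoped BigOperators Topology Classical
open Filter Set Metric
open Literature.Probability.LatticeModels Literature.Probability.RandomPlanarGeometry
open Literature.Probability.RandomPlanarGeometry.SAW
open Literature.Probability.Percolation (hexCenter_im)
open Summit.CriticalPhenomena.SAWScalingLimit.Theorems.ObservableToSLE.FloorRatio (dist_smul_mesh)

namespace Summit.CriticalPhenomena.SAWScalingLimit.Theorems.PolygonParitySqueeze.GateDbar

/-! ### 1. Heights of face centres -/

/-- `1.7 < √3`. [folklore] -/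
theorem sqrt_three_gt : (1.7 : ℝ) < Real.sqrt 3 := by
  rw [show (1.7 : ℝ) = Real.sqrt (1.7 ^ 2) by rw [Real.sqrt_sq (by norm_num)]]
  exact Real.sqrt_lt_sqrt (by norm_num) (by norm_num)

/-- **Heights versus rows.** The centre of a face `v` of row `v.1 1` lies at height between
`(v.1 1 + 1/3)·√3/2` (up faces) and `(v.1 1 + 2/3)·√3/2` (down faces). [folklore] -/
theorem im_hexCenter_bounds (v : HexVertex) :
    ((v.1 1 : ℝ) + 1 / 3) * (Real.sqrt 3 / 2) ≤ (hexCenter v).im ∧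
      (hexCenter v).im ≤ ((v.1 1 : ℝ) + 2 / 3) * (Real.sqrt 3 / 2) := by
  obtain ⟨y, i⟩ := v
  rw [hexCenter_im]
  have hs : 0 ≤ Real.sqrt 3 / 2 := by positivity
  have hi : (0 : ℝ) ≤ ((i : ℕ) : ℝ) ∧ ((i : ℕ) : ℝ) ≤ 1 := by fin_cases i <;> simp
  constructor
  · refine mul_le_mul_of_nonneg_right ?_ hs
    simp only
    linarith [hi.1]
  · refine mul_le_mul_of_nonneg_right ?_ hs
    simp only
    linarith [hi.2]

/-! ### 2. Depth of the rows above the gate -/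

/-- **Rows are deep.** Let membership in `Λ` be decided by the row threshold `m` for every face with
`δ`-scaled centre in `B(c, ρ)`.  A face `v` of row `m + k` with scaled centre in `B(c, ρ/4)` is
`(k+1)/2`-deep as soon as `δ (k+1) ≤ ρ`: every face `y` with `dist (c_y) (c_v) ≤ (k+1)/2` lies in
`Λ` (its scaled centre is in `B(c, ρ)`, and its row is `≥ m` since rows are `√3/2` apart while
`(k + 2/3)·√3/2 > (k+1)/2`). [folklore] -/
theorem deep_of_row {Λ : Finset HexVertex} {m : ℤ} {δ ρ : ℝ} {c : ℂ} (hδ : 0 < δ)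
    (hpin : ∀ y : HexVertex, (δ : ℂ) * hexCenter y ∈ ball c ρ → (y ∈ Λ ↔ m ≤ y.1 1))
    {v : HexVertex} {k : ℕ} (hrow : v.1 1 = m + k) (hv : (δ : ℂ) * hexCenter v ∈ ball c (ρ / 4))
    (hk : δ * ((k : ℝ) + 1) ≤ ρ) :
    ∀ y : HexVertex, dist (hexCenter y) (hexCenter v) ≤ ((k : ℝ) + 1) / 2 → y ∈ Λ := by
  intro y hy
  have hk0 : (0 : ℝ) ≤ k := Nat.cast_nonneg k
  -- the scaled centre of `y` is pinned
  have hyball : (δ : ℂ) * hexCenter y ∈ ball c ρ := by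
    rw [mem_ball] at hv ⊢
    have h1 : dist ((δ : ℂ) * hexCenter y) ((δ : ℂ) * hexCenter v) ≤ δ * (((k : ℝ) + 1) / 2) := by
      rw [dist_smul_mesh hδ.le]; exact mul_le_mul_of_nonneg_left hy hδ.le
    calc dist ((δ : ℂ) * hexCenter y) c
        ≤ dist ((δ : ℂ) * hexCenter y) ((δ : ℂ) * hexCenter v) + dist ((δ : ℂ) * hexCenter v) c :=
          dist_triangle _ _ _
      _ < δ * (((k : ℝ) + 1) / 2) + ρ / 4 := add_lt_add_of_le_of_lt h1 hv
      _ ≤ ρ := by nlinarith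
  refine (hpin y hyball).2 ?_
  -- the row of `y` is at least `m`
  by_contra hlt
  push Not at hlt
  have hy1 : (y.1 1 : ℝ) ≤ m - 1 := by exact_mod_cast Int.le_sub_one_of_lt hlt
  have hvim := (im_hexCenter_bounds v).1
  have hyim := (im_hexCenter_bounds y).2
  have hdiff : (hexCenter v).im - (hexCenter y).im ≤ ((k : ℝ) + 1) / 2 := by
    have h1 : |(hexCenter y - hexCenter v).im| ≤ ‖hexCenter y - hexCenter v‖ := Complex.abs_im_le_norm _
    rw [Complex.sub_im, ← dist_eq_norm] at h1
    have h2 := (abs_le.1 (h1.trans hy)).1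
    linarith
  rw [hrow] at hvim
  push_cast at hvim
  have h3 := sqrt_three_gt
  nlinarith [mul_nonneg hk0 (Real.sqrt_nonneg 3)]

/-! ### 3. Only `O(ρ/δ)` rows meet the quarter ball -/

/-- **Row count.** Under the pin at `c` (radius `ρ`), if the floor line of the threshold row is
within `ρ/4` of the height of `c` (`|δ m √3/2 − im c| < ρ/4`, eventually true by
`GateMass.tendsto_floorHeight`), then a vertex of `Λ` with scaled centre in `B(c, ρ/4)` lies in a
row `m + k` with `k < ρ/δ`. [folklore] -/
theorem exists_row_lt {Λ : Finset HexVertex} {m : ℤ} {δ ρ : ℝ} {c : ℂ} (hδ : 0 < δ)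
    (hpin : ∀ y : HexVertex, (δ : ℂ) * hexCenter y ∈ ball c ρ → (y ∈ Λ ↔ m ≤ y.1 1))
    (hfloor : |δ * (m : ℝ) * (Real.sqrt 3 / 2) - c.im| < ρ / 4)
    {v : HexVertex} (hvΛ : v ∈ Λ) (hv : (δ : ℂ) * hexCenter v ∈ ball c (ρ / 4)) :
    ∃ k : ℕ, v.1 1 = m + k ∧ (k : ℝ) < ρ / δ := by
  have hρ4 : ρ / 4 ≤ ρ := by
    have : 0 < ρ / 4 := lt_of_le_of_lt dist_nonneg (mem_ball.1 hv)
    linarith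
  have hmv : m ≤ v.1 1 := (hpin v (ball_subset_ball hρ4 hv)).1 hvΛ
  obtain ⟨k, hk⟩ : ∃ k : ℕ, v.1 1 = m + k := ⟨(v.1 1 - m).toNat, by omega⟩
  refine ⟨k, hk, ?_⟩
  have hk0 : (0 : ℝ) ≤ k := Nat.cast_nonneg k
  -- height of `δ c_v` is below `im c + ρ/4`
  have hup : ((δ : ℂ) * hexCenter v).im < c.im + ρ / 4 := by
    have h1 : |((δ : ℂ) * hexCenter v - c).im| ≤ ‖(δ : ℂ) * hexCenter v - c‖ := Complex.abs_im_le_norm _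
    rw [Complex.sub_im, ← dist_eq_norm] at h1
    have h2 := (abs_lt.1 (lt_of_le_of_lt h1 (mem_ball.1 hv))).2
    linarith
  have hvim := (im_hexCenter_bounds v).1
  rw [hk] at hvim
  push_cast at hvim
  rw [Complex.mul_im, Complex.ofReal_re, Complex.ofReal_im, zero_mul, add_zero] at hup
  have hfl := (abs_lt.1 hfloor).1
  have h3 := sqrt_three_gt
  -- `δ (k + 1/3) √3/2 < ρ/2`, so `δ k < ρ`
  have hmul : δ * (((k : ℝ) + 1 / 3) * (Real.sqrt 3 / 2)) < ρ / 2 := by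
    have := mul_le_mul_of_nonneg_left hvim hδ.le
    nlinarith
  rw [lt_div_iff₀ hδ]
  nlinarith [mul_nonneg hδ.le hk0, Real.sqrt_nonneg 3, mul_nonneg (mul_nonneg hδ.le hk0) (Real.sqrt_nonneg 3)]

/-! ### 4. The layer cake -/

/-- **Layer cake.** Under the pin at `c` (radius `ρ`) with the floor line within `ρ/4` of `im c`,
suppose the ROW BUDGET at mesh `δ`: `δ Σ_{v ∈ Λ, δ c_v ∈ B(c, ρ/4), v.1 1 = m + k} starMass ≤
C_B (k+1)^{3/4} Z_b` for every `k : ℕ`.  Then for nonnegative row weights `w` and any `K` with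
`ρ/δ ≤ K + 1`, `δ Σ_{v ∈ Λ, δ c_v ∈ B(c, ρ/4)} w(row v − m) starMass(v) ≤
C_B Z_b Σ_{k ≤ K} w(k) (k+1)^{3/4}`. [cite: LawlerSchrammWerner2004SAW, §3.4 (restriction / boundary scaling heuristics)] -/
theorem layerCake_le {Λ : Finset HexVertex} {m : ℤ} {δ ρ CB Zb : ℝ} {c : ℂ} {a : Sym2 HexVertex}
    (hδ : 0 < δ)
    (hpin : ∀ y : HexVertex, (δ : ℂ) * hexCenter y ∈ ball c ρ → (y ∈ Λ ↔ m ≤ y.1 1))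
    (hfloor : |δ * (m : ℝ) * (Real.sqrt 3 / 2) - c.im| < ρ / 4)
    (hbudget : ∀ k : ℕ, δ * (∑ᶠ v ∈ {v : HexVertex | v ∈ Λ ∧ (δ : ℂ) * hexCenter v ∈ ball c (ρ / 4) ∧
        v.1 1 = m + k}, starMass Λ a v) ≤ CB * ((k : ℝ) + 1) ^ (3 / 4 : ℝ) * Zb)
    (w : ℕ → ℝ) (hw : ∀ k, 0 ≤ w k) {K : ℕ} (hK : ρ / δ ≤ (K : ℝ) + 1) :
    δ * ∑ v ∈ Λ.filter (fun v => (δ : ℂ) * hexCenter v ∈ ball c (ρ / 4)),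
        w (v.1 1 - m).toNat * starMass Λ a v ≤
      CB * Zb * ∑ k ∈ Finset.range (K + 1), w k * ((k : ℝ) + 1) ^ (3 / 4 : ℝ) := by
  classical
  set S := Λ.filter (fun v => (δ : ℂ) * hexCenter v ∈ ball c (ρ / 4)) with hS
  set g : HexVertex → ℕ := fun v => (v.1 1 - m).toNat with hg
  -- every vertex of `S` lies in a row `k ≤ K`
  have hrow : ∀ v ∈ S, ∃ k : ℕ, v.1 1 = m + k ∧ g v = k ∧ k ∈ Finset.range (K + 1) := by
    intro v hv
    obtain ⟨hvΛ, hvb⟩ := Finset.mem_filter.1 hv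
    obtain ⟨k, hk, hkK⟩ := exists_row_lt hδ hpin hfloor hvΛ hvb
    refine ⟨k, hk, by simp [hg, hk], Finset.mem_range.2 ?_⟩
    have : (k : ℝ) < (K : ℝ) + 1 := lt_of_lt_of_le hkK hK
    exact_mod_cast this
  have hmaps : ∀ v ∈ S, g v ∈ Finset.range (K + 1) := fun v hv => by
    obtain ⟨k, -, hgk, hk⟩ := hrow v hv; rw [hgk]; exact hk
  rw [← Finset.sum_fiberwise_of_maps_to hmaps, Finset.mul_sum, Finset.mul_sum]
  refine Finset.sum_le_sum fun k hk => ?_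
  -- the fibre over `k` is the row-`k` window
  have hfib : ∀ v ∈ S.filter (fun v => g v = k), w (v.1 1 - m).toNat * starMass Λ a v =
      w k * starMass Λ a v := by
    intro v hv
    obtain ⟨-, hgv⟩ := Finset.mem_filter.1 hv
    rw [← hgv]
  rw [Finset.sum_congr rfl hfib, ← Finset.mul_sum]
  have hset : (↑(S.filter (fun v => g v = k)) : Set HexVertex) =
      {v : HexVertex | v ∈ Λ ∧ (δ : ℂ) * hexCenter v ∈ ball c (ρ / 4) ∧ v.1 1 = m + k} := by
    ext v
    simp only [Finset.coe_filter, Set.mem_setOf_eq, hS, Finset.mem_filter]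
    constructor
    · rintro ⟨⟨hvΛ, hvb⟩, hgv⟩
      obtain ⟨k', hk', hgk', -⟩ := hrow v (Finset.mem_filter.2 ⟨hvΛ, hvb⟩)
      rw [hgk'] at hgv
      subst hgv
      exact ⟨hvΛ, hvb, hk'⟩
    · rintro ⟨hvΛ, hvb, hk'⟩
      exact ⟨⟨hvΛ, hvb⟩, by simp [hg, hk']⟩
  have hfin : ∑ v ∈ S.filter (fun v => g v = k), starMass Λ a v =
      ∑ᶠ v ∈ {v : HexVertex | v ∈ Λ ∧ (δ : ℂ) * hexCenter v ∈ ball c (ρ / 4) ∧ v.1 1 = m + k},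
        starMass Λ a v := by
    rw [← hset, finsum_mem_coe_finset]
  have hbk := hbudget k
  calc δ * (w k * ∑ v ∈ S.filter (fun v => g v = k), starMass Λ a v)
      = w k * (δ * ∑ᶠ v ∈ {v : HexVertex | v ∈ Λ ∧ (δ : ℂ) * hexCenter v ∈ ball c (ρ / 4) ∧
          v.1 1 = m + k}, starMass Λ a v) := by rw [hfin]; ring
    _ ≤ w k * (CB * ((k : ℝ) + 1) ^ (3 / 4 : ℝ) * Zb) := mul_le_mul_of_nonneg_left hbk (hw k)
    _ = CB * Zb * (w k * ((k : ℝ) + 1) ^ (3 / 4 : ℝ)) := by ring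

/-! ### 5. Power sums -/

/-- `Σ_{k < K} (k+1)^{-s} ≤ K^{1-s}/(1-s)` for `0 ≤ s < 1` (telescoping with the weighted AM–GM
inequality `K^{1-s}(K+1)^s ≤ K + s`). [folklore] -/
theorem sum_range_rpow_neg_le (K : ℕ) {s : ℝ} (hs0 : 0 ≤ s) (hs1 : s < 1) :
    ∑ k ∈ Finset.range K, ((k : ℝ) + 1) ^ (-s) ≤ (K : ℝ) ^ (1 - s) / (1 - s) := by
  have h1s : 0 < 1 - s := by linarith
  induction K with
  | zero => simp [Real.zero_rpow h1s.ne']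
  | succ K ih =>
    rw [Finset.sum_range_succ]
    have hK0 : (0 : ℝ) ≤ K := Nat.cast_nonneg K
    have hK1 : (0 : ℝ) < (K : ℝ) + 1 := by positivity
    set P : ℝ := ((K : ℝ) + 1) ^ s with hP
    set Q : ℝ := ((K : ℝ) + 1) ^ (-s) with hQ
    have hPpos : 0 < P := Real.rpow_pos_of_pos hK1 _
    have hPQ : P * Q = 1 := by
      rw [hQ, Real.rpow_neg hK1.le, hP, mul_inv_cancel₀ hPpos.ne']
    have hQpos : 0 < Q := Real.rpow_pos_of_pos hK1 _
    -- weighted AM–GM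
    have hAG : (K : ℝ) ^ (1 - s) * P ≤ (K : ℝ) + s := by
      have := Real.geom_mean_le_arith_mean2_weighted (w₁ := 1 - s) (w₂ := s) (p₁ := (K : ℝ))
        (p₂ := (K : ℝ) + 1) h1s.le hs0 hK0 hK1.le (by ring)
      rw [hP]
      linarith
    have hsucc : ((K + 1 : ℕ) : ℝ) ^ (1 - s) = ((K : ℝ) + 1) * Q := by
      push_cast
      rw [show (1 - s : ℝ) = 1 + -s by ring, Real.rpow_add hK1, Real.rpow_one]
    rw [hsucc]
    have key : (K : ℝ) ^ (1 - s) ≤ ((K : ℝ) + s) * Q := by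
      calc (K : ℝ) ^ (1 - s) = (K : ℝ) ^ (1 - s) * P * Q := by rw [mul_assoc, hPQ, mul_one]
        _ ≤ ((K : ℝ) + s) * Q := mul_le_mul_of_nonneg_right hAG hQpos.le
    calc ∑ k ∈ Finset.range K, ((k : ℝ) + 1) ^ (-s) + Q ≤ (K : ℝ) ^ (1 - s) / (1 - s) + Q := by
          linarith [ih]
      _ ≤ ((K : ℝ) + s) * Q / (1 - s) + Q := by gcongr
      _ = ((K : ℝ) + 1) * Q / (1 - s) := by field_simp; ring

/-- `Σ_{k < K} (k+1)^p ≤ K^{p+1}` for `0 ≤ p` (every term is at most `K^p`). [folklore] -/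
theorem sum_range_rpow_le (K : ℕ) {p : ℝ} (hp : 0 ≤ p) :
    ∑ k ∈ Finset.range K, ((k : ℝ) + 1) ^ p ≤ (K : ℝ) ^ (p + 1) := by
  have hK0 : (0 : ℝ) ≤ K := Nat.cast_nonneg K
  have hterm : ∀ k ∈ Finset.range K, ((k : ℝ) + 1) ^ p ≤ (K : ℝ) ^ p := by
    intro k hk
    have hk' : (k : ℝ) + 1 ≤ K := by exact_mod_cast Nat.succ_le_of_lt (Finset.mem_range.1 hk)
    exact Real.rpow_le_rpow (by positivity) hk' hp
  calc ∑ k ∈ Finset.range K, ((k : ℝ) + 1) ^ p ≤ ∑ _k ∈ Finset.range K, (K : ℝ) ^ p :=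
        Finset.sum_le_sum hterm
    _ = (K : ℝ) * (K : ℝ) ^ p := by rw [Finset.sum_const, Finset.card_range, nsmul_eq_mul]
    _ = (K : ℝ) ^ (p + 1) := by
        rcases hK0.lt_or_eq with hpos | h0
        · rw [Real.rpow_add hpos, Real.rpow_one, mul_comm]
        · have hp1 : p + 1 ≠ 0 := by positivity
          rw [← h0, Real.zero_rpow hp1, zero_mul]

/-- **The decaying power sum at the lattice cut-off.** For `0 < δ ≤ ρ`, `K ≤ ρ/δ` and `0 ≤ s < 1`:
`δ Σ_{k ≤ K} (k+1)^{-s} ≤ (2ρ)^{1-s}/(1-s) · δ^s`. [folklore] -/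
theorem delta_mul_sum_decay_le {δ ρ s : ℝ} {K : ℕ} (hδ : 0 < δ) (hδρ : δ ≤ ρ) (hK : (K : ℝ) ≤ ρ / δ)
    (hs0 : 0 ≤ s) (hs1 : s < 1) :
    δ * ∑ k ∈ Finset.range (K + 1), ((k : ℝ) + 1) ^ (-s) ≤
      (2 * ρ) ^ (1 - s) / (1 - s) * δ ^ s := by
  have h1s : 0 < 1 - s := by linarith
  have hK1 : ((K + 1 : ℕ) : ℝ) ≤ 2 * ρ / δ := by
    push_cast
    have : (1 : ℝ) ≤ ρ / δ := by rw [le_div_iff₀ hδ]; linarith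
    have e : 2 * ρ / δ = 2 * (ρ / δ) := by ring
    linarith
  have hpow : ((K + 1 : ℕ) : ℝ) ^ (1 - s) ≤ (2 * ρ / δ) ^ (1 - s) :=
    Real.rpow_le_rpow (Nat.cast_nonneg _) hK1 h1s.le
  have hsplit : (2 * ρ / δ) ^ (1 - s) = (2 * ρ) ^ (1 - s) * δ ^ s / δ := by
    rw [Real.div_rpow (by linarith) hδ.le, Real.rpow_sub hδ, Real.rpow_one]
    field_simp
  calc δ * ∑ k ∈ Finset.range (K + 1), ((k : ℝ) + 1) ^ (-s)
      ≤ δ * (((K + 1 : ℕ) : ℝ) ^ (1 - s) / (1 - s)) :=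
        mul_le_mul_of_nonneg_left (sum_range_rpow_neg_le (K + 1) hs0 hs1) hδ.le
    _ ≤ δ * ((2 * ρ / δ) ^ (1 - s) / (1 - s)) := by gcongr
    _ = (2 * ρ) ^ (1 - s) / (1 - s) * δ ^ s := by rw [hsplit]; field_simp

/-- **The growing power sum at the lattice cut-off.** For `0 < δ ≤ ρ` and `K ≤ ρ/δ`:
`δ² Σ_{k ≤ K} (k+1)^{3/4} ≤ (2ρ)^{7/4} · δ^{1/4}`. [folklore] -/
theorem delta_sq_mul_sum_growth_le {δ ρ : ℝ} {K : ℕ} (hδ : 0 < δ) (hδρ : δ ≤ ρ) (hK : (K : ℝ) ≤ ρ / δ) :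
    δ ^ 2 * ∑ k ∈ Finset.range (K + 1), ((k : ℝ) + 1) ^ (3 / 4 : ℝ) ≤
      (2 * ρ) ^ (7 / 4 : ℝ) * δ ^ (1 / 4 : ℝ) := by
  have hK1 : ((K + 1 : ℕ) : ℝ) ≤ 2 * ρ / δ := by
    push_cast
    have : (1 : ℝ) ≤ ρ / δ := by rw [le_div_iff₀ hδ]; linarith
    have e : 2 * ρ / δ = 2 * (ρ / δ) := by ring
    linarith
  have hpow : ((K + 1 : ℕ) : ℝ) ^ ((3 / 4 : ℝ) + 1) ≤ (2 * ρ / δ) ^ ((3 / 4 : ℝ) + 1) :=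
    Real.rpow_le_rpow (Nat.cast_nonneg _) hK1 (by norm_num)
  have hsplit : (2 * ρ / δ) ^ ((3 / 4 : ℝ) + 1) = (2 * ρ) ^ (7 / 4 : ℝ) * δ ^ (1 / 4 : ℝ) / δ ^ 2 := by
    rw [show ((3 / 4 : ℝ) + 1) = 7 / 4 by norm_num, Real.div_rpow (by linarith) hδ.le]
    have h2 : δ ^ (2 : ℝ) = δ ^ (7 / 4 : ℝ) * δ ^ (1 / 4 : ℝ) := by
      rw [← Real.rpow_add hδ]; norm_num
    rw [← Real.rpow_two, h2]
    have h7 : 0 < δ ^ (7 / 4 : ℝ) := Real.rpow_pos_of_pos hδ _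
    have h4 : 0 < δ ^ (1 / 4 : ℝ) := Real.rpow_pos_of_pos hδ _
    field_simp
  calc δ ^ 2 * ∑ k ∈ Finset.range (K + 1), ((k : ℝ) + 1) ^ (3 / 4 : ℝ)
      ≤ δ ^ 2 * ((K + 1 : ℕ) : ℝ) ^ ((3 / 4 : ℝ) + 1) :=
        mul_le_mul_of_nonneg_left (sum_range_rpow_le (K + 1) (by norm_num)) (by positivity)
    _ ≤ δ ^ 2 * (2 * ρ / δ) ^ ((3 / 4 : ℝ) + 1) := by gcongr
    _ = (2 * ρ) ^ (7 / 4 : ℝ) * δ ^ (1 / 4 : ℝ) := by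
        rw [hsplit]; field_simp

/-! ### Registered form (sub-goal of `stub_gateDbarLimit`) -/

/-- **Registered sub-goal `gateDbar_layerCake`** (crux item stmt-CriticalPhenomena-14004, line
`polygon-parity-squeeze`, stub `stub_gateDbarLimit`, mechanism (C)): registry form (one `∀`-term) of
`layerCake_le` — the row-by-row domination of weighted star-mass sums over the quarter gate ball by
the gate layer budget. [cite: LawlerSchrammWerner2004SAW, §3.4 (restriction / boundary scaling heuristics)] -/
theorem gateDbar_layerCake : ∀ (Λ : Finset HexVertex) (m : ℤ) (δ ρ CB Zb : ℝ) (c : ℂ) (a : Sym2 HexVertex), 0 < δ → (∀ y : HexVertex, (δ : ℂ) * hexCenter y ∈ Metric.ball c ρ → (y ∈ Λ ↔ m ≤ y.1 1)) → |δ * (m : ℝ) * (Real.sqrt 3 / 2) - c.im| < ρ / 4 → (∀ k : ℕ, δ * (∑ᶠ v ∈ {v : HexVertex | v ∈ Λ ∧ (δ : ℂ) * hexCenter v ∈ Metric.ball c (ρ / 4) ∧ v.1 1 = m + k}, starMass Λ a v) ≤ CB * ((k : ℝ) + 1) ^ (3 / 4 : ℝ) * Zb) → ∀ (w : ℕ →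 ℝ), (∀ k, 0 ≤ w k) → ∀ (K : ℕ), ρ / δ ≤ (K : ℝ) + 1 → δ * ∑ v ∈ Λ.filter (fun v => (δ : ℂ) * hexCenter v ∈ Metric.ball c (ρ / 4)), w (v.1 1 - m).toNat * starMass Λ a v ≤ CB * Zb * ∑ k ∈ Finset.range (K + 1), w k * ((k : ℝ) + 1) ^ (3 / 4 : ℝ) :=
  fun _ _ _ _ _ _ _ _ hδ hpin hfloor hbudget w hw _ hK => layerCake_le hδ hpin hfloor hbudget w hw hK

end Summit.CriticalPhenomena.SAWScalingLimit.Theorems.PolygonParitySqueeze.GateDbar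

end
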